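import Mathlib
import Summits.Ventures.PercRepro2.Inst8Kernel

/-!
# The `|F| = 10` four-mark unmarked triangle: the kernel certificate (blind cell PercRepro2, typer-1 g14)

S4's named object that remains under the twenty flat conditions (S4-HARDSTEP v46): the marks
`o = 0, a₁ = 1, a₂ = 2, a₃ = 3, b = 4`, the unmarked triangle `u = 5, w = 6, x = 7`, with `u ~ o`,
`w ~ a₁`, `x ~ a₃`, `x ~ b` and the path `a₁ – o – a₂ – b`; ten edges in the order
`uw, wx, ux, ou, a₁w, a₃x, bx, oa₁, oa₂, a₂b`.  `cert_tri10` is the digitwise-dominance certificate of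
`K₃` on it (one `decide +kernel`; Python twins `tri10_direct.c` / `tri10_kron.py`: all `4^10`
profiles, 0 negative, max digit 30,677, the two codes digit for digit).
-/

namespace Summit.Ventures.PercRepro2

namespace Inst8

/-- First endpoints of the triangle instance. -/
def triEa : Fin 10 → ℕ
  | 0 => 5 | 1 => 6 | 2 => 5 | 3 => 0 | 4 => 1 | 5 => 3 | 6 => 4 | 7 => 0 | 8 => 0 | 9 => 2

/-- Second endpoints of the triangle instance. -/
def triEb : Fin 10 → ℕ
  | 0 => 6 | 1 => 7 | 2 => 7 | 3 => 5 | 4 => 6 | 5 => 7 | 6 => 7 | 7 => 1 | 8 => 2 | 9 => 4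

/-- **The `|F| = 10` four-mark unmarked triangle** as an instance graph. -/
def tri10 : Inst where
  ea := triEa
  eb := triEb
  ea_lt := by decide
  eb_lt := by decide
  ea_ne_eb := by decide

set_option maxRecDepth 100000 in
/-- **The certificate of `K₃` on the triangle instance** (marks distinct, `b = 4`). -/
theorem cert_tri10 : Cert3 tri10 4 := by
  unfold Cert3
  decide +kernel

end Inst8

end Summit.Ventures.PercRepro2
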